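import Summits.QuantumAdvantage.QuantumAdvantage.Theorems.LinnikCubicClassGroupsDegreeOnePrimesEscapeConjClassThetaRelative
import Summits.QuantumAdvantage.QuantumAdvantage.Theorems.LinnikCubicClassGroupsDegreeOnePrimesEscapeConjClassPNTRelativePrelims
import HarnessLib

/-!
# The Chebotarev prime number theorem in the Linnik range for a Galois extension of an ARBITRARY number field

Topic `Summits/QuantumAdvantage/QuantumAdvantage/Theorems`, cell B2b-1 (linnik-cubic), PART A (gen 16); helper
toward the crux `DegreeOnePrimesEscape` (stmt-QuantumAdvantage-11543).  HONEST FRAMING: the value of this file is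
a THEOREM (kernel-checked, GRH-free, Siegel-free, no hypothesis) — NOT summit progress.

`frobeniusClass_PNT_all` (`…ConjClassPNTAll.lean`, gen 13) is the Lagarias–Montgomery–Odlyzko prime number
theorem for the conjugacy classes of `Gal(N/ℚ)`.  Lagarias–Montgomery–Odlyzko (Theorem 1.1, §9) and
Thorner–Zaman (Theorem 1.4) work over an arbitrary base: `L/F` Galois, primes `𝔭` of `F` counted by `N_{F/ℚ} 𝔭`.
This file removes the restriction `F = ℚ`:

**Theorem** (`frobeniusClass_PNT_relative`).  For `n > 1` and `0 < ε ≤ 1` there are `L = L(n,ε) > 0`,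
`c = c(n,ε) > 0` such that for every tower `ℚ ⊆ F ⊆ N` of number fields with `N/F` Galois, `[N:ℚ] = n`,
`G = Gal(N/F)`, and EVERY `σ ∈ G`, with `C = C(σ)`, `δ = |C|/|G|`, `d = |d_N|`, and
`S(x) = Σ log N𝔮` over the primes `𝔮` of `F` with `N𝔮 = p ≤ x` a rational prime, `p ∤ d_N`, and `Frob_𝔮 ∈ C`
(some prime `𝔔 ∣ 𝔮` of `N` with trivial inertia has an arithmetic Frobenius over `𝓞_F` conjugate to `σ`):
* (A) if `ζ_N` has no real zero in `(1 − c/(log d + log 4), 1)`: `|S(x) − δ x| ≤ ε δ x` for every `x ≥ d^L`;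
* (B) if `β₁` is such a zero then for every `x ≥ d^L`, with `y = x^{β₁}/β₁`:
  `0 < x − y` and `|S(x) − δ (x − y)| ≤ ε δ (x − y)` when `ζ_{N^{⟨σ⟩}}(β₁) = 0`, and
  `|S(x) − δ (x + y)| ≤ ε δ (x + y)` when `ζ_{N^{⟨σ⟩}}(β₁) ≠ 0`.
(The primes of `F` of degree `≥ 2` over `ℚ`, at most `[F:ℚ] √x` of them below `x`, are not counted; the range
and the constants depend on the absolute degree `n` only.)

Proof: verbatim the gen-13 assembly — Deuring's reduction to the cyclic extension `N | E = N^{⟨σ⟩} ⊇ F`, the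
every-base Hecke input `frobeniusPsi_dichotomy_signed_all`, and the threshold numerics of the division chain — with
the prime bookkeeping over `F` (`abs_card_mul_psiFrob_sub_le_rel`, `…ConjClassThetaRelative.lean`, resting on the
Literature's relative Deuring count `DegreeOnePrimesRel.card_mul_card_frob_eq_card_conj_eq`) in place of the
bookkeeping over `ℚ`.
-/

noncomputable section

open scoped NumberField nonZeroDivisors Classical
open Finset Real Ideal NumberField IsDedekindDomain
open Literature.NumberTheory.NumberFields Literature.NumberTheory.LFunctions
  Literature.NumberTheory.LFunctions.NumberField Literature.NumberTheory.GaloisRepresentations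

namespace Summit.QuantumAdvantage.QuantumAdvantage.Theorems.DegreeOnePrimesEscape

set_option maxHeartbeats 4000000 in
/-- **The Chebotarev prime number theorem for a conjugacy class of `Gal(N/F)` in the Linnik range, ARBITRARY BASE `F`,
relative error `ε`** (Lagarias–Montgomery–Odlyzko / Thorner–Zaman shape; see the module docstring: `δ = |C(σ)|/|G|`,
`S(x) = Σ_{𝔮 ⊂ 𝓞_F, N𝔮 = p ≤ x prime, p ∤ d_N, Frob_𝔮 ∈ C(σ)} log N𝔮`, `d = |d_N|`, EVERY `σ ∈ Gal(N/F)`):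
(A) no real zero of `ζ_N` in `(1 − c/(log d + log 4), 1)` ⟹ `|S(x) − δx| ≤ εδx` for `x ≥ d^L`;
(B) `β₁` such a zero, `y = x^{β₁}/β₁` ⟹ for `x ≥ d^L`: `0 < x − y ∧ |S(x) − δ(x − y)| ≤ εδ(x − y)` if
`ζ_{N^{⟨σ⟩}}(β₁) = 0`, and `|S(x) − δ(x + y)| ≤ εδ(x + y)` otherwise.  Unconditional.
[cite: LagariasMontgomeryOdlyzko1979, Theorem 1.1, §9] [cite: ThornerZaman2019, Theorem 1.4] -/
theorem frobeniusClass_PNT_relative (n : ℕ) (hn : 1 < n) {ε : ℝ} (hε : 0 < ε) (hε1 : ε ≤ 1) :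
    ∃ L c : ℝ, 0 < L ∧ 0 < c ∧ c ≤ 1 / 4 ∧ ∀ (F N : Type) [Field F] [NumberField F] [Field N] [NumberField N]
      [Algebra F N] [IsGalois F N], Module.finrank ℚ N = n → ∀ σ : N ≃ₐ[F] N,
        ((¬ ∃ β₁ : ℝ, dedekindZeta₁ N β₁ = 0 ∧
            1 - c / (Real.log ((NumberField.discr N).natAbs : ℝ) + Real.log 4) < β₁ ∧ β₁ < 1) →
          ∀ x : ℝ, ((NumberField.discr N).natAbs : ℝ) ^ L ≤ x →
            |∑ q ∈ (finite_primeIdealsLE F x).toFinset with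
                ((Ideal.absNorm q).Prime ∧ ¬ ((Ideal.absNorm q : ℤ) ∣ NumberField.discr N) ∧
                  ∃ (Q : Ideal (𝓞 N)) (_ : Q.IsMaximal) (_ : Q.LiesOver q) (φ g : N ≃ₐ[F] N),
                    IsArithFrobAt (𝓞 F) φ Q ∧ Q.inertia (N ≃ₐ[F] N) = ⊥ ∧ g * φ * g⁻¹ = σ),
                Real.log (Ideal.absNorm q : ℝ) -
              (Nat.card {τ : N ≃ₐ[F] N // IsConj σ τ} : ℝ) / Nat.card (N ≃ₐ[F] N) * x| ≤
              ε * ((Nat.card {τ : N ≃ₐ[F] N // IsConj σ τ} : ℝ) / Nat.card (N ≃ₐ[F] N) * x)) ∧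
        (∀ β₁ : ℝ, dedekindZeta₁ N β₁ = 0 →
          1 - c / (Real.log ((NumberField.discr N).natAbs : ℝ) + Real.log 4) < β₁ → β₁ < 1 →
          (dedekindZeta₁ (IntermediateField.fixedField (Subgroup.zpowers σ)) β₁ = 0 →
            ∀ x : ℝ, ((NumberField.discr N).natAbs : ℝ) ^ L ≤ x →
              0 < x - x ^ β₁ / β₁ ∧
              |∑ q ∈ (finite_primeIdealsLE F x).toFinset with
                  ((Ideal.absNorm q).Prime ∧ ¬ ((Ideal.absNorm q : ℤ) ∣ NumberField.discr N) ∧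
                    ∃ (Q : Ideal (𝓞 N)) (_ : Q.IsMaximal) (_ : Q.LiesOver q) (φ g : N ≃ₐ[F] N),
                      IsArithFrobAt (𝓞 F) φ Q ∧ Q.inertia (N ≃ₐ[F] N) = ⊥ ∧ g * φ * g⁻¹ = σ),
                  Real.log (Ideal.absNorm q : ℝ) -
                (Nat.card {τ : N ≃ₐ[F] N // IsConj σ τ} : ℝ) / Nat.card (N ≃ₐ[F] N) * (x - x ^ β₁ / β₁)| ≤
                ε * ((Nat.card {τ : N ≃ₐ[F] N // IsConj σ τ} : ℝ) / Nat.card (N ≃ₐ[F] N) *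
                  (x - x ^ β₁ / β₁))) ∧
          (dedekindZeta₁ (IntermediateField.fixedField (Subgroup.zpowers σ)) β₁ ≠ 0 →
            ∀ x : ℝ, ((NumberField.discr N).natAbs : ℝ) ^ L ≤ x →
              |∑ q ∈ (finite_primeIdealsLE F x).toFinset with
                  ((Ideal.absNorm q).Prime ∧ ¬ ((Ideal.absNorm q : ℤ) ∣ NumberField.discr N) ∧
                    ∃ (Q : Ideal (𝓞 N)) (_ : Q.IsMaximal) (_ : Q.LiesOver q) (φ g : N ≃ₐ[F] N),
                      IsArithFrobAt (𝓞 F) φ Q ∧ Q.inertia (N ≃ₐ[F] N) = ⊥ ∧ g * φ * g⁻¹ = σ),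
                  Real.log (Ideal.absNorm q : ℝ) -
                (Nat.card {τ : N ≃ₐ[F] N // IsConj σ τ} : ℝ) / Nat.card (N ≃ₐ[F] N) * (x + x ^ β₁ / β₁)| ≤
                ε * ((Nat.card {τ : N ≃ₐ[F] N // IsConj σ τ} : ℝ) / Nat.card (N ≃ₐ[F] N) *
                  (x + x ^ β₁ / β₁)))) := by
  have hn0 : (0 : ℝ) < n := by exact_mod_cast (lt_trans Nat.zero_lt_one hn)
  have hn1 : (1 : ℝ) ≤ n := by exact_mod_cast hn.le
  -- the analytic input, at `η = ε/8`
  set η : ℝ := ε / 8 with hη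
  have hη0 : 0 < η := by positivity
  obtain ⟨a₂, c, c', ha₂1, hc, hcn, hc'0, hc'c, hmain⟩ := frobeniusPsi_dichotomy_signed_all n hn hη0
  obtain ⟨c₁, hc₁, hc₁1, hMT⟩ := exceptional_mainTerm_ge' n hn
  obtain ⟨L₀, hL₀0, hW⟩ := rpow_div_le_of_ge_window hc'0 hη0
  set ε₀ : ℝ := ε / 80 with hε₀
  have hε₀0 : 0 < ε₀ := by positivity
  have hε₀1 : ε₀ ≤ 1 := by rw [hε₀]; linarith
  have hX1 : (1 : ℝ) ≤ Real.exp 16 := Real.one_le_exp (by norm_num)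
  obtain ⟨L₂, hL₂, -, -, hthr⟩ := division_thresholds_eps n hn 0 hc₁ hc₁1 hX1 le_rfl hε₀0 hε₀1
  set e : ℝ := 1 + n * Real.log n / Real.log 3 with he
  have hlog3 : 0 < Real.log 3 := Real.log_pos (by norm_num)
  have hlogn : 0 ≤ Real.log n := Real.log_nonneg hn1
  have he0 : 0 ≤ (n : ℝ) * Real.log n / Real.log 3 := by positivity
  have he1 : 1 ≤ e := by rw [he]; linarith
  set L : ℝ := max (max (e * a₂) 8) (max L₀ L₂) with hL
  have hLea : e * a₂ ≤ L := le_trans (le_max_left _ _) (le_max_left _ _)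
  have hL8 : (8 : ℝ) ≤ L := le_trans (le_max_right _ _) (le_max_left _ _)
  have hLL₀ : L₀ ≤ L := le_trans (le_max_left _ _) (le_max_right _ _)
  have hLL₂ : L₂ ≤ L := le_trans (le_max_right _ _) (le_max_right _ _)
  have hc4' : c ≤ 1 / 4 :=
    hcn.trans (by rw [div_le_div_iff_of_pos_left one_pos (by positivity) (by norm_num)]; nlinarith)
  refine ⟨L, c', by linarith, hc'0, hc'c.trans hc4', fun F N _ _ _ _ _ _ hN σ => ?_⟩
  -- sizes depending on `N`
  have hN1 : 1 < Module.finrank ℚ N := by rw [hN]; exact hn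
  set d : ℝ := ((NumberField.discr N).natAbs : ℝ) with hd
  have hd3 : (3 : ℝ) ≤ d := three_le_natAbs_discr_real N hN1
  obtain ⟨hd0, hd1⟩ : (0 : ℝ) < d ∧ (1 : ℝ) ≤ d := ⟨by linarith, by linarith⟩
  have hlogd0 : 0 < Real.log d := Real.log_pos (by linarith)
  have hlog4 : 0 < Real.log 4 := Real.log_pos (by norm_num)
  -- the fixed field of `⟨σ⟩`
  set H : Subgroup (N ≃ₐ[F] N) := Subgroup.zpowers σ with hH
  set E : IntermediateField F N := IntermediateField.fixedField H with hE
  have hfix : E.fixingSubgroup = H := IntermediateField.fixingSubgroup_fixedField H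
  have hσE : σ ∈ E.fixingSubgroup := by rw [hfix]; exact Subgroup.mem_zpowers σ
  haveI : IsCyclic E.fixingSubgroup := by rw [hfix]; infer_instance
  haveI : IsCyclic (N ≃ₐ[E] N) :=
    isCyclic_of_surjective (IntermediateField.fixingSubgroupEquiv E).toMonoidHom
      (IntermediateField.fixingSubgroupEquiv E).surjective
  have hcomm : ∀ a b : N ≃ₐ[E] N, Commute a b := fun a b => IsCyclic.commGroup.mul_comm a b
  haveI : FiniteDimensional E N := Module.Finite.of_restrictScalars_finite ℚ E N
  set τ' : N ≃ₐ[E] N := IntermediateField.fixingSubgroupEquiv E ⟨σ, hσE⟩ with hτ'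
  set m : ℕ := Module.finrank E N with hm
  have hcardm : Nat.card (N ≃ₐ[E] N) = m := IsGalois.card_aut_eq_finrank E N
  have horder : orderOf τ' = m := by
    rw [hτ', MulEquiv.orderOf_eq, Subgroup.orderOf_mk, ← Nat.card_zpowers, ← hH, ← hcardm,
      ← Nat.card_congr (IntermediateField.fixingSubgroupEquiv E).toEquiv, hfix]
  obtain ⟨χ₁, hχ₁, hA, hB, hB'⟩ := hmain E N hN
  -- the Frobenius weight of `σ`
  set w : Ideal (𝓞 E) → ℝ := fun I => if (∃ v : HeightOneSpectrum (𝓞 E),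
    Algebra.IsUnramifiedIn (𝓞 N) v.asIdeal ∧ ∃ k : ℕ, I = v.asIdeal ^ k ∧ galFrob E N v ^ k = τ') then 1 else 0
    with hwdef
  have hw : ∀ I, w I = if (∃ v : HeightOneSpectrum (𝓞 E), Algebra.IsUnramifiedIn (𝓞 N) v.asIdeal ∧
      ∃ k : ℕ, I = v.asIdeal ^ k ∧ galFrob E N v ^ k = τ') then 1 else 0 := fun I => rfl
  -- group-theoretic constants
  set ν : ℝ := (Nat.card (Subgroup.centralizer ({σ} : Set (N ≃ₐ[F] N))) : ℝ) with hν
  have hνpos : 0 < ν := by rw [hν]; exact_mod_cast card_centralizer_pos σ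
  set δ : ℝ := (Nat.card {τ : N ≃ₐ[F] N // IsConj σ τ} : ℝ) / Nat.card (N ≃ₐ[F] N) with hδ
  have hG0 : (0 : ℝ) < Nat.card (N ≃ₐ[F] N) := by exact_mod_cast Nat.card_pos
  have hδν : δ * ν = 1 := by
    rw [hδ, hν, div_mul_eq_mul_div, div_eq_one_iff_eq hG0.ne']
    exact_mod_cast card_isConj_mul_card_centralizer σ
  -- `x ≥ d^L`: the thresholds
  have hQd : ThornerZaman.condQn N ≤ d ^ e := by
    have h := condQn_le_natAbs_discr_rpow N hN1
    rw [hN] at h; exact h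
  have hQ0 : (0 : ℝ) ≤ ThornerZaman.condQn N := by
    have := ThornerZaman.twelve_le_condQn (K := N) hN1; linarith
  have hx_facts : ∀ x : ℝ, d ^ L ≤ x → ThornerZaman.condQn N ^ a₂ ≤ x ∧ d ^ L₀ ≤ x ∧ d ^ L₂ ≤ x ∧
      d ≤ x ^ (1 / 8 : ℝ) ∧ 1 < x ∧ 16 ≤ Real.log x := by
    intro x hx
    have hmono : ∀ {a b : ℝ}, a ≤ b → d ^ a ≤ d ^ b := fun hab => Real.rpow_le_rpow_of_exponent_le hd1 hab
    have hQ : ThornerZaman.condQn N ^ a₂ ≤ x := by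
      calc ThornerZaman.condQn N ^ a₂ ≤ (d ^ e) ^ a₂ := Real.rpow_le_rpow hQ0 hQd (by linarith)
        _ = d ^ (e * a₂) := by rw [Real.rpow_mul hd0.le]
        _ ≤ d ^ L := hmono hLea
        _ ≤ x := hx
    have hL₂x : d ^ L₂ ≤ x := (hmono hLL₂).trans hx
    obtain ⟨hXx, -, -, -, -⟩ := hthr d hd3 x hL₂x
    have hx16 : 16 ≤ Real.log x := by
      have := Real.log_le_log (Real.exp_pos 16) hXx; rwa [Real.log_exp] at this
    have hx1 : 1 < x := by linarith [Real.add_one_le_exp (16 : ℝ)]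
    have hd8 : d ≤ x ^ (1 / 8 : ℝ) := by
      have h8 : d ^ (8 : ℝ) ≤ x := (hmono hL8).trans hx
      have := Real.rpow_le_rpow (Real.rpow_nonneg hd0.le _) h8 (by norm_num : (0 : ℝ) ≤ 1 / 8)
      rwa [← Real.rpow_mul hd0.le, show (8 : ℝ) * (1 / 8) = 1 by norm_num, Real.rpow_one] at this
    exact ⟨hQ, (hmono hLL₀).trans hx, hL₂x, hd8, hx1, hx16⟩
  -- the comparison `|m ψ_σ(x) − ν S(x)| ≤ R(x) ≤ 40 n x^{3/4}`
  have hcomp : ∀ x : ℝ, d ^ L ≤ x →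
      |(m : ℝ) * (∑ k ∈ Icc 0 ⌊x⌋₊, ∑ I ∈ idealsOfNorm E k, w I * idealVonMangoldt I) -
        ν * ∑ q ∈ (finite_primeIdealsLE F x).toFinset with
          ((Ideal.absNorm q).Prime ∧ ¬ ((Ideal.absNorm q : ℤ) ∣ NumberField.discr N) ∧
            ∃ (Q : Ideal (𝓞 N)) (_ : Q.IsMaximal) (_ : Q.LiesOver q) (φ g : N ≃ₐ[F] N),
              IsArithFrobAt (𝓞 F) φ Q ∧ Q.inertia (N ≃ₐ[F] N) = ⊥ ∧ g * φ * g⁻¹ = σ),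
          Real.log (Ideal.absNorm q : ℝ)| ≤
        40 * n * x ^ (3 / 4 : ℝ) := by
    intro x hx
    obtain ⟨-, -, -, hd8, hx1, -⟩ := hx_facts x hx
    have h := abs_card_mul_psiFrob_sub_le_rel (N := N) E hcomm hσE hw hx1.le
    rw [hcardm] at h
    have hj := classJunk_le' (E := E) (N := N) hx1 hd8
    rw [hcardm, hN] at hj
    exact h.trans hj
  -- `3/4 ≤ β₁` for a zero in the `c`-window (a fortiori in the `c'`-window)
  have hβ34_of : ∀ {cc β₁ : ℝ}, cc ≤ c → 1 - cc / (Real.log d + Real.log 4) < β₁ → 3 / 4 ≤ β₁ := by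
    intro cc β₁ hcc hwin
    have hlog4' : 1 < Real.log 4 := by
      rw [show (4:ℝ) = 2 ^ 2 by norm_num, Real.log_pow]; have := Real.log_two_gt_d9; push_cast; linarith
    have : cc / (Real.log d + Real.log 4) ≤ 1 / 4 := by
      rw [div_le_iff₀ (by linarith)]; nlinarith
    linarith
  refine ⟨?_, ?_⟩
  · -- (A): no zero in the `c'`-window
    intro hexc x hx
    obtain ⟨hQx, hL₀x, hL₂x, hd8, hx1, hx16⟩ := hx_facts x hx
    have hx0 : 0 < x := by linarith
    obtain ⟨-, h34, -, -, -⟩ := hthr d hd3 x hL₂x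
    -- `|m ψ − x| ≤ (ε/4) x`, whether or not a zero hides in the `c`-window
    have h1 : |(m : ℝ) * (∑ k ∈ Icc 0 ⌊x⌋₊, ∑ I ∈ idealsOfNorm E k, w I * idealVonMangoldt I) - 1 * x| ≤
        ε / 2 * (1 * x) := by
      simp only [one_mul]
      by_cases hz : ∃ β₁ : ℝ, dedekindZeta₁ N β₁ = 0 ∧
          1 - c / (Real.log ((NumberField.discr N).natAbs : ℝ) + Real.log 4) < β₁ ∧ β₁ < 1
      · obtain ⟨β₁, hζ, hwin, hβ1⟩ := hz
        have hβc' : β₁ ≤ 1 - c' / (Real.log d + Real.log 4) := by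
          by_contra hlt
          exact hexc ⟨β₁, hζ, lt_of_not_ge hlt, hβ1⟩
        have hβ34 := hβ34_of le_rfl hwin
        obtain ⟨j₀, -, hBf⟩ := hB β₁ hζ hwin hβ1
        have h := hBf τ' w hw x hQx
        rw [← hm] at h
        set r : ℝ := ((((χ₁ τ' : ℂˣ) : ℂ)⁻¹) ^ j₀).re with hr
        have hrle : |r| ≤ 1 := by
          refine (Complex.abs_re_le_norm _).trans ?_
          rw [norm_pow]; exact pow_le_one₀ (norm_nonneg _) (norm_inv_character_le_one χ₁ τ')
        have hy : x ^ β₁ / β₁ ≤ η * x := hW d hd3 x hL₀x β₁ (by linarith) hβc'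
        have hy0 : 0 ≤ x ^ β₁ / β₁ := div_nonneg (Real.rpow_nonneg hx0.le _) (by linarith)
        have hmin : min 1 ((1 - β₁) * Real.log x) ≤ 1 := min_le_left _ _
        have hmin0 : 0 ≤ min 1 ((1 - β₁) * Real.log x) :=
          le_min zero_le_one (mul_nonneg (by linarith) (by linarith))
        have hηx : η * x * min 1 ((1 - β₁) * Real.log x) ≤ η * x :=
          by nlinarith [mul_pos hη0 hx0]
        have hry : |r * x ^ β₁ / β₁| ≤ η * x := by
          rw [mul_div_assoc, abs_mul, abs_of_nonneg hy0]
          calc |r| * (x ^ β₁ / β₁) ≤ 1 * (η * x) := mul_le_mul hrle hy hy0 zero_le_one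
            _ = η * x := one_mul _
        have hεx : 0 ≤ ε * x := by positivity
        rw [abs_le] at h hry ⊢
        rw [hη] at h hry hηx
        obtain ⟨hl, hu⟩ := h
        obtain ⟨hl', hu'⟩ := hry
        constructor <;> linarith
      · have h := hA τ' w hw x hQx hz
        rw [← hm] at h
        rw [hη] at h
        have : ε / 8 * x ≤ ε / 2 * x := by nlinarith [mul_pos hε hx0]
        exact h.trans this
    have h2 := hcomp x hx
    have h3 : 40 * (n : ℝ) * x ^ (3 / 4 : ℝ) ≤ ε / 2 * (1 * x) := by
      have hn2 : (1 : ℝ) ≤ 4 * n ^ 2 := by nlinarith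
      have : ε₀ * x / (4 * n ^ 2) ≤ ε₀ * x := div_le_self (by positivity) hn2
      rw [hε₀] at this h34
      nlinarith
    exact division_transfer hνpos hδν h1 h2 h3
  · -- (B): a zero `β₁` in the `c'`-window
    intro β₁ hζ hwin hβ1
    have hβ34 : 3 / 4 ≤ β₁ := hβ34_of hc'c hwin
    have hβ0 : 0 < β₁ := by linarith
    obtain ⟨j₀, hj₀m, hiff, hsq, hBf⟩ := hB' β₁ hζ hwin hβ1
    refine ⟨fun hζE x hx => ?_, fun hζE x hx => ?_⟩
    · -- `ζ_E(β₁) = 0`: the sign is `+1`, main term `x − y`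
      obtain ⟨hQx, hL₀x, hL₂x, hd8, hx1, hx16⟩ := hx_facts x hx
      have hx0 : 0 < x := by linarith
      have hj0 : j₀ = 0 := hiff.mpr hζE
      have h := hBf τ' w hw x hQx
      rw [← hm] at h
      rw [hj0, pow_zero, Complex.one_re, one_mul] at h
      have hMain := sub_mul_rpow_div_ge (r := 1) hx1 hx16 hβ34 hβ1 (by rw [abs_one])
      rw [one_mul] at hMain
      have hWxy : x * c₁ / (4 * d ^ (2 * ((1 : ℝ) + n * n))) ≤ x - x ^ β₁ / β₁ :=
        hMT N hN β₁ hζ hβ34 hβ1 x hx1 hx16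
      have hW0 : 0 < x * c₁ / (4 * d ^ (2 * ((1 : ℝ) + n * n))) := by positivity
      have hxy : 0 < x - x ^ β₁ / β₁ := lt_of_lt_of_le hW0 hWxy
      refine ⟨hxy, ?_⟩
      have hmin0 : 0 ≤ min 1 ((1 - β₁) * Real.log x) :=
        le_min zero_le_one (mul_nonneg (by linarith) (by linarith))
      have h1 : |(m : ℝ) * (∑ k ∈ Icc 0 ⌊x⌋₊, ∑ I ∈ idealsOfNorm E k, w I * idealVonMangoldt I) -
          1 * (x - x ^ β₁ / β₁)| ≤ ε / 2 * (1 * (x - x ^ β₁ / β₁)) := by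
        simp only [one_mul]
        refine h.trans ?_
        rw [hη]
        nlinarith [mul_nonneg hε.le hmin0]
      have h2 := hcomp x hx
      obtain ⟨-, -, -, h34c, -⟩ := hthr d hd3 x hL₂x
      have h3 : 40 * (n : ℝ) * x ^ (3 / 4 : ℝ) ≤ ε / 2 * (1 * (x - x ^ β₁ / β₁)) := by
        have hn2 : (1 : ℝ) ≤ 4 * n ^ 2 := by nlinarith
        have : ε₀ * (x * c₁ / (4 * d ^ (2 * ((1 : ℝ) + n * n)))) / (4 * n ^ 2) ≤
            ε₀ * (x * c₁ / (4 * d ^ (2 * ((1 : ℝ) + n * n)))) := div_le_self (by positivity) hn2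
        rw [hε₀] at this h34c
        nlinarith [mul_pos hε hW0]
      exact division_transfer hνpos hδν h1 h2 h3
    · -- `ζ_E(β₁) ≠ 0`: the sign is `−1`, main term `x + y`
      obtain ⟨hQx, hL₀x, hL₂x, hd8, hx1, hx16⟩ := hx_facts x hx
      have hx0 : 0 < x := by linarith
      have hj0 : j₀ ≠ 0 := fun h0 => hζE (hiff.mp h0)
      have hneg : ((χ₁ τ' : ℂˣ) : ℂ) ^ j₀ = -1 :=
        character_pow_eq_neg_one χ₁ hχ₁ τ' horder (Nat.pos_of_ne_zero hj0) hj₀m (hsq τ')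
      have hre : ((((χ₁ τ' : ℂˣ) : ℂ)⁻¹) ^ j₀).re = -1 := by
        rw [inv_pow, hneg, inv_neg, inv_one, Complex.neg_re, Complex.one_re]
      have h := hBf τ' w hw x hQx
      rw [← hm] at h
      rw [hre] at h
      have hMain := sub_mul_rpow_div_ge (r := -1) hx1 hx16 hβ34 hβ1 (by rw [abs_neg, abs_one])
      have hy0 : 0 ≤ x ^ β₁ / β₁ := div_nonneg (Real.rpow_nonneg hx0.le _) hβ0.le
      have hmin0 : 0 ≤ min 1 ((1 - β₁) * Real.log x) :=
        le_min zero_le_one (mul_nonneg (by linarith) (by linarith))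
      have e1 : x - (-1) * x ^ β₁ / β₁ = x + x ^ β₁ / β₁ := by ring
      rw [e1] at h hMain
      have h1 : |(m : ℝ) * (∑ k ∈ Icc 0 ⌊x⌋₊, ∑ I ∈ idealsOfNorm E k, w I * idealVonMangoldt I) -
          1 * (x + x ^ β₁ / β₁)| ≤ ε / 2 * (1 * (x + x ^ β₁ / β₁)) := by
        simp only [one_mul]
        refine h.trans ?_
        rw [hη]
        nlinarith [mul_nonneg hε.le hmin0]
      have h2 := hcomp x hx
      obtain ⟨-, h34, -, -, -⟩ := hthr d hd3 x hL₂x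
      have h3 : 40 * (n : ℝ) * x ^ (3 / 4 : ℝ) ≤ ε / 2 * (1 * (x + x ^ β₁ / β₁)) := by
        have hn2 : (1 : ℝ) ≤ 4 * n ^ 2 := by nlinarith
        have : ε₀ * x / (4 * n ^ 2) ≤ ε₀ * x := div_le_self (by positivity) hn2
        rw [hε₀] at this h34
        nlinarith [mul_nonneg hε.le hy0]
      exact division_transfer hνpos hδν h1 h2 h3

end Summit.QuantumAdvantage.QuantumAdvantage.Theorems.DegreeOnePrimesEscape

end
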